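import Summits.Ventures.Crystal3D.Theorems.StickyWulffConstantGenericWallFloorShellRowCertDefs
import HarnessLib

/-!
# The DOCKED MENU of a grain as an INTEGER TABLE (crux `GenericWallFloor`, stmt-Ventures-19480, line `WallLedgerG`;
# cf-p1 ORDER 2026-08-28T20:38Z (1): «stated so cf-p2's enumeration output plugs in as a finite table»)

HONEST FRAMING. Venture `Summits/Ventures/Crystal3D` (cell `crystal3d-full`), helper vocabulary for the crux `GenericWallFloor`
of `route-Ventures-StickyWulffConstant`, REGISTERED line `WallLedgerG`, open stub `stub_twoSlabAdhesion`.  DEFINITIONS ONLY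
(computable `Finset`s of integer triples; the bridge to the universe lemma `menu_or_payer_of_near_endBall` of
`…GenericWallFloorEndBallUniverse` is the sequel `…GenericWallFloorEndBallMenuTable`).  Nothing is claimed about packings;
F-C1 not moved.

COORDINATES (the tree's, `…ShellRowCertDefs`): an integer triple `q3` stands for the vector `pointVec q3` whose CUBIC
coordinates (orthonormal `cubicFrame`) are `q3 / (3√2)`; the twelve slots are `3 • slotInt i` (`pointVec (3 • slotInt i) =
slotSite i`), squared length of `pointVec q3` is `sdot3 q3 q3 / 18`.
* `dozenQ3 o` — the nine EXACT DOZENS of the identity grain: `o = none` the slot dozen `{3σ}`; `o = some c` the TWIN DOZEN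
  across the `{111}` plane with normal `cubeInt c`: the nine slots `3σ` with `σ ⬝ c ≤ 0` and the three mirror images
  `3σ + 4c` of the slots with `σ ⬝ c < 0` (`σ − 2(σ⬝c/3)c` with `σ ⬝ c = −2`) — in the grain frame `A` this is
  `{A w : ⟪A w, n⟫ ≤ 0} ∪ {A w − 2⟪A w, n⟫ n : ⟪A w, n⟫ < 0}`, `n = A(c/√3)`, the currency of `DockedMenu`.
* `menuQ3` — THE DOCKED MENU: all `v − v′` and `−v′` with `v′, v` in ONE dozen `dozenQ3 o` (the relative positions, seen
  from an end ball `z` docked at `z − v′`, of the docking ball and of its twelve contacts; `0 ∈ menuQ3` from `v = v′`).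
  207 triples (206 non-zero; enumeration HOME/wall-p1-g11/menu.py), squared lengths `sdot3 q q ∈ {0, 18, 36, 48, 54, 66, 72}`
  (`sdot3_dozenQ3`), i.e. distances `{0, 1, √2, √(8/3), √3, √(11/3), 2}`; 147 of them within `√3`, 75 within `√(8/3)`;
  `mem_menuQ3_iff` unfolds membership.
WHAT THIS IS NOT: no statement about configurations; F-C1 not moved.
-/

namespace Summit.Ventures.Crystal3D.Theorems

open Finset NearIdentity

/-- **The nine exact dozens of the identity grain** (integer cubic coordinates `×3`): `none` ↦ the slot dozen
`{3 • slotInt i}`; `some c` ↦ the twin dozen across the `{111}` plane normal to `cubeInt c` — the slots with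
`slotInt i ⬝ cubeInt c ≤ 0` and the mirror images `3 • slotInt i + 4 • cubeInt c` of those with `slotInt i ⬝ cubeInt c < 0`. -/
def dozenQ3 : Option (Fin 8) → Finset (Fin 3 → ℤ)
  | none => Finset.univ.image fun i : Fin 12 => 3 • slotInt i
  | some c =>
      ((Finset.univ.filter fun i : Fin 12 => sdot3 (slotInt i) (cubeInt c) ≤ 0).image fun i => 3 • slotInt i) ∪
        ((Finset.univ.filter fun i : Fin 12 => sdot3 (slotInt i) (cubeInt c) < 0).image fun i =>
          3 • slotInt i + 4 • cubeInt c)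

/-- **The docked menu** (integer cubic coordinates `×3`): the relative positions `−v′` (the docking ball) and `v − v′`
(its contacts) for `v′, v` in one exact dozen `dozenQ3 o`, over all nine dozens. -/
def menuQ3 : Finset (Fin 3 → ℤ) :=
  Finset.univ.biUnion fun o : Option (Fin 8) =>
    (dozenQ3 o).biUnion fun v' => insert (-v') ((dozenQ3 o).image fun v => v - v')

/-- Each exact dozen has twelve vectors. -/
theorem card_dozenQ3 : ∀ o : Option (Fin 8), (dozenQ3 o).card = 12 := by decide +kernel

/-- Every dozen vector has squared length `18` (length `1`), and two distinct vectors of one dozen differ by a vector of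
squared length `18, 36, 48, 54, 66` or `72` (distance `1, √2, √(8/3), √3, √(11/3), 2`) — so every non-zero menu vector has one
of these seven squared lengths. -/
theorem sdot3_dozenQ3 : ∀ o : Option (Fin 8), ∀ v' ∈ dozenQ3 o, sdot3 v' v' = 18 ∧ ∀ v ∈ dozenQ3 o, v ≠ v' →
    sdot3 (v - v') (v - v') = 18 ∨ sdot3 (v - v') (v - v') = 36 ∨ sdot3 (v - v') (v - v') = 48 ∨
      sdot3 (v - v') (v - v') = 54 ∨ sdot3 (v - v') (v - v') = 66 ∨ sdot3 (v - v') (v - v') = 72 := by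
  decide +kernel

/-- Unfolding `menuQ3`: `q` is on the menu iff `q = −v′` or `q = v − v′` with `v′, v` in one exact dozen. -/
theorem mem_menuQ3_iff (q : Fin 3 → ℤ) :
    q ∈ menuQ3 ↔ ∃ o : Option (Fin 8), ∃ v' ∈ dozenQ3 o, q = -v' ∨ ∃ v ∈ dozenQ3 o, q = v - v' := by
  constructor
  · intro h
    obtain ⟨o, -, h⟩ := Finset.mem_biUnion.1 h
    obtain ⟨v', hv', h⟩ := Finset.mem_biUnion.1 h
    rcases Finset.mem_insert.1 h with h | h
    · exact ⟨o, v', hv', Or.inl h⟩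
    · obtain ⟨v, hv, rfl⟩ := Finset.mem_image.1 h
      exact ⟨o, v', hv', Or.inr ⟨v, hv, rfl⟩⟩
  · rintro ⟨o, v', hv', h⟩
    refine Finset.mem_biUnion.2 ⟨o, Finset.mem_univ _, Finset.mem_biUnion.2 ⟨v', hv', ?_⟩⟩
    rcases h with rfl | ⟨v, hv, rfl⟩
    · exact Finset.mem_insert_self _ _
    · exact Finset.mem_insert_of_mem (Finset.mem_image.2 ⟨v, hv, rfl⟩)

end Summit.Ventures.Crystal3D.Theorems
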